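import Summits.MatrixMultiplication.MatrixMultiplication.Theorems.SoloInformedCwTwoDemotion
import Summits.MatrixMultiplication.MatrixMultiplication.Theorems.SoloInformedCwTwoOnePairOrient

/-!
# Obligation relations force rigidity (solo-informed, gen 13; CLAIMS c165–c167)

Data (c165): in every hard two-pair mixed design each pair `k` carries an OBLIGATION RELATION — a coincidence
involving its untraded value `s_k + d_k` — and the dominant type is `s_k + d_k = d_o ± t`, `s_o + d_o = (d_k - s_k) ± t`.
Here the easy direction is typed: an obligation relation of pattern `(0,-1)`, `(1,-1)` or `(-1,0)` for the last
pair makes the last-pair demotion a NON-design (so such designs fall under the residual hypotheses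
`HalfOrientRigidStep` / `LevelRigidStep`).  The certificates are Theorem A's hypotheses `hd`, `hds`, `hs`
(`onePair_hypotheses_of_isMixedDesign`) evaluated on the two new singleton positions.

Standard axioms only.
-/

namespace Summit.MatrixMultiplication.MatrixMultiplication.Theorems

open Finset

/-- Old subsets keep their sums in the demoted system. -/
lemma subsetSum_demote_map {p q : ℕ} (s d : Fin (p + 1) → ℕ) (t : Fin q → ℕ) (B : Finset (Fin q)) :
    subsetSum (demoteT s d t) (B.map (demoteEmb q)) = subsetSum t B := by
  simp [subsetSum, Finset.sum_map, demoteEmb, demoteT]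

/-- An old subset together with both new positions sums to the old sum plus the untraded value `s + d`. -/
lemma subsetSum_demote_union {p q : ℕ} (s d : Fin (p + 1) → ℕ) (t : Fin q → ℕ) (B : Finset (Fin q)) :
    subsetSum (demoteT s d t) (B.map (demoteEmb q) ∪ demoteExtra q 3) =
      subsetSum t B + (s (Fin.last p) + d (Fin.last p)) := by
  unfold subsetSum
  rw [Finset.sum_union (disjoint_map_demoteExtra _ _), sum_demoteExtra]
  have := subsetSum_demote_map s d t B
  unfold subsetSum at this
  rw [this]
  simp

/-- Obligation of pattern `(0,-1)`: `s₁ + d₁ + ΣB = d₀ + ΣA` makes the demotion of pair `1` a non-design. -/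
theorem not_isMixedDesign_demote_of_obligation_d {q : ℕ} (s d : Fin 2 → ℕ) (t : Fin q → ℕ)
    (A B : Finset (Fin q)) (h : s 1 + d 1 + subsetSum t B = d 0 + subsetSum t A) :
    ¬ IsMixedDesign (fun i : Fin 1 => s i.castSucc) (fun i => d i.castSucc) (demoteT s d t) := by
  intro hD
  obtain ⟨-, -, hd, -, -⟩ := onePair_hypotheses_of_isMixedDesign _ _ _ hD
  refine hd (A.map (demoteEmb q)) (B.map (demoteEmb q) ∪ demoteExtra q 3) ?_
  rw [subsetSum_demote_union, subsetSum_demote_map]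
  have h1 : (Fin.last 1 : Fin 2) = 1 := rfl
  have h0 : ((0 : Fin 1).castSucc : Fin 2) = 0 := rfl
  simp only [h1, h0]
  omega

/-- Obligation of pattern `(1,-1)`: `s₀ + (s₁ + d₁) + ΣB = d₀ + ΣA` makes the demotion of pair `1` a non-design. -/
theorem not_isMixedDesign_demote_of_obligation_ds {q : ℕ} (s d : Fin 2 → ℕ) (t : Fin q → ℕ)
    (A B : Finset (Fin q)) (h : s 0 + (s 1 + d 1) + subsetSum t B = d 0 + subsetSum t A) :
    ¬ IsMixedDesign (fun i : Fin 1 => s i.castSucc) (fun i => d i.castSucc) (demoteT s d t) := by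
  intro hD
  obtain ⟨-, -, -, hds, -⟩ := onePair_hypotheses_of_isMixedDesign _ _ _ hD
  refine hds (A.map (demoteEmb q)) (B.map (demoteEmb q) ∪ demoteExtra q 3) ?_
  rw [subsetSum_demote_union, subsetSum_demote_map]
  have h1 : (Fin.last 1 : Fin 2) = 1 := rfl
  have h0 : ((0 : Fin 1).castSucc : Fin 2) = 0 := rfl
  simp only [h1, h0]
  omega

/-- Obligation of pattern `(-1,0)`: `s₁ + d₁ + ΣB = s₀ + ΣA` makes the demotion of pair `1` a non-design. -/
theorem not_isMixedDesign_demote_of_obligation_s {q : ℕ} (s d : Fin 2 → ℕ) (t : Fin q → ℕ)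
    (A B : Finset (Fin q)) (h : s 1 + d 1 + subsetSum t B = s 0 + subsetSum t A) :
    ¬ IsMixedDesign (fun i : Fin 1 => s i.castSucc) (fun i => d i.castSucc) (demoteT s d t) := by
  intro hD
  obtain ⟨-, hs, -, -, -⟩ := onePair_hypotheses_of_isMixedDesign _ _ _ hD
  refine hs (A.map (demoteEmb q)) (B.map (demoteEmb q) ∪ demoteExtra q 3) ?_
  rw [subsetSum_demote_union, subsetSum_demote_map]
  have h1 : (Fin.last 1 : Fin 2) = 1 := rfl
  have h0 : ((0 : Fin 1).castSucc : Fin 2) = 0 := rfl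
  simp only [h1, h0]
  omega

/-- Example (the hard design `(3,78 | 28,81 ; 34)`, c165): `3 + (28 + 81) = 78 + 34`, so demoting the pair `(28,81)`
leaves a non-design. -/
example : ¬ IsMixedDesign (fun i : Fin 1 => (![3, 28] : Fin 2 → ℕ) i.castSucc)
    (fun i => (![78, 81] : Fin 2 → ℕ) i.castSucc) (demoteT ![3, 28] ![78, 81] ![34]) :=
  not_isMixedDesign_demote_of_obligation_ds ![3, 28] ![78, 81] ![34] {0} ∅ (by decide)

end Summit.MatrixMultiplication.MatrixMultiplication.Theorems
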